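import Literature.NumberTheory.PAdicHodge.BmaxPlusFrobeniusLogSumThetaValue
import Literature.NumberTheory.PAdicHodge.AinfRamifiedHodgeLineEvaluation
import Literature.NumberTheory.PAdicHodge.BdRPlusEmbedding
import HarnessLib

/-!
# θ of the Hodge combination of the TRANSPORTED crystalline periods of a ramified good model:
# `θ_dR(A·f(Λ_w) + B·f(φΛ_w)) = p^N · log_{W_D}(u₀)` for `w = Tu` the CM-fibre transport, and `= 0` on the Tate module

Topic `Literature/NumberTheory/PAdicHodge`; namespace `Literature.NumberTheory.PAdicHodge.AinfRamTop`. THEOREMS ONLY (no definition, no named fact, no instance,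
no `sorry`). The junction of the analytic half (J1–J4: `SecondKindColmezFunctional{,Transport,HodgeLine}`, `FormalLogValuesIntegralCoeff`,
`AinfRamifiedHodgeLineEvaluation`) with the `A_max`-half (T2a `BmaxPlusLogSumThetaValue`, T2b `BmaxPlusFrobeniusLogSumThetaValue`) of the «CM-fibre transport»
road. Setting: `F` a `p`-adic field with `θ` onto, `D` an Eisenstein datum (`𝒪_D = ℤ_p[ϖ] ⊆ 𝒪_F`), `W = W_D` a Weierstrass equation over `𝒪_D` and `E₀/ℤ`
with a HODGE LINE `‖p^d·[Xⁿ](log_{W_D} − A·ℓ − B·ℓ^{(p)})‖ ≤ 1` (`ℓ = log_{E₀}`, `A, B ∈ F`; supplied for `W_D ≡ E₀ (mod ϖ)` by the Summits-side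
`TransportedHodgeLine.exists_hodgeLine_eval`, p770176, with `A = Σ aᵢϖⁱ`, `B = Σ bᵢϖⁱ`), an exact `[p]_{W_D}`-division tower `u` of `Ŵ_D(𝔪_{ℂ_F})`, an exact
`[p]_{E₀}`-tower `w` with `‖wₙ − uₙ‖ ≤ ‖ϖ‖` (its transport), Fontaine's integral `[w̃]`, the period `Λ_w = Λ_N(ι[w̃], z) ∈ A_max` and the honest map
`f = bmaxPlusToBdR`; `F ↪ B_dR⁺` by `embBdRHom` (`θ ∘ emb = (F ⊆ ℂ_F)`).

* ★★★ `thetaBdR_transportedHodgeCombination_eq` — **`θ_dR(emb A · f(Λ_w) + emb B · f(φΛ_w)) = p^N · log_{W_D}(u₀)`** (`log_{W_D}(u₀) := Σ'[Xʲ]log_{W_D}·u₀ʲ`):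
  `θ(fΛ_w) = p^N·ℓ(w₀)` (T2a), `θ(fφΛ_w) = p^N·𝒞_w(ℓ^{(p)})` (T2b), `A·ℓ(w₀) + B·𝒞_w(ℓ^{(p)}) = log_{W_D}(u₀)` (HL-eval).
* ★★ `thetaBdR_transportedHodgeCombination_eq_zero_of_torsion` — on a TORSION tower (`u₀ = 0`, `u ∈ T_pŴ_D`): **the combination lies in `ker θ_dR = Fil¹`**.

Purpose (crux K★ `stmt-BirchSwinnertonDyer-22226`, line `kato_lever`, memo `Lines/kato-lever-K2-ramified-cm-transport.md` §9, T2/T4): these are the hypotheses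
`hfil` (`Pω″ := A·P⁰ + B·Q⁰ ⊆ Fil¹` on the Tate module) and `hθb` (`θ(b″) = p^N·log_{W_D}(P)`, the integrating element of the Kummer tower of a rational point
`P`) of the socket's capstone for the TRANSPORTED crystalline pair `(P⁰, Q⁰) = (f∘Λ∘T, f∘φ∘Λ∘T)` of a K★ cell — with every input kernel-proved (no Breuil–Kisin
module). What remains (T5) is plumbing: packaging `P⁰, Q⁰` as `TatePtO W_D →+ BdRPlusTop` and feeding the capstone. Infrastructure only; BSD / K★ are not
proved by any of this.

## References
* P. Colmez, *Périodes p-adiques des variétés abéliennes*, Math. Ann. 292 (1992), §2. [Colmez1992PeriodesAbeliennes]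
* N. M. Katz, *Crystalline cohomology, Dieudonné modules, and Jacobi sums* (1981), §5.1, Thm. 5.1.4–5.1.5, Thm. 5.3.3. [Katz1981CrystallineDieudonne]
* J.-M. Fontaine, *Le corps des périodes p-adiques*, Astérisque 223 (1994), Exp. II §1.5.3 (`F ↪ B_dR⁺`). [FontaineAsterisque223III]
-/

noncomputable section

open Ideal WittVector ValuativeRel Field Filter
open scoped Topology Classical

namespace Literature.NumberTheory.PAdicHodge

namespace AinfRamTop

open Literature.NumberTheory.GaloisRepresentations Literature.NumberTheory.GaloisRepresentations.IsNonarchimedeanLocalField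
open Literature.NumberTheory.GaloisRepresentations.LubinTate Literature.NumberTheory.EllipticCurves
open Literature.RingTheory.FormalGroups Literature.AlgebraicGeometry.Resolution GaloisContinuity

variable {F : Type} [Field F] [ValuativeRel F] [TopologicalSpace F] [IsNonarchimedeanLocalField F] [CharZero F]
  {p : ℕ} [hpp : Fact p.Prime] {hp : valuation F p < 1} (D : EisensteinRoot F p hp)
  [Fact (¬ IsUnit (p : integerC F))] [IsAdicComplete (Ideal.span {(p : integerC F)}) (integerC F)]
  {hθ : Function.Surjective (fontaineTheta (integerC F) p)} [CharZero (CompletedAlgClosure F)]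

set_option maxHeartbeats 1600000 in
/-- ★★★ **θ of the Hodge combination of the transported periods.** With the notation of the module docstring (Hodge line `(A, B, d)` over `F`, exact
`[p]_{W_D}`-tower `u`, exact `[p]_{E₀}`-tower `w` with `‖wₙ − uₙ‖ ≤ ‖ϖ‖`, period `Λ_w = Λ_N(ι[w̃], z)`):
**`θ_dR(emb(A)·f(Λ_w) + emb(B)·f(φΛ_w)) = p^N · Σ'[Xʲ]log_{W_D}·u₀ʲ`**. [cite: Colmez1992PeriodesAbeliennes, §2]
[cite: Katz1981CrystallineDieudonne, Thm. 5.1.4–5.1.5, Thm. 5.3.3] -/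
theorem thetaBdR_transportedHodgeCombination_eq (W : WeierstrassCurve (EisensteinRoot.CoeffDisc D)) (E₀ : WeierstrassCurve ℤ) (A B : F) (d : ℕ)
    (hHL : ∀ n : ℕ, ‖(p : CompletedAlgClosure F) ^ d * PowerSeries.coeff n
        ((W.map ((CBall F).subtype.comp (EisensteinRoot.CoeffDisc.toCBall D))).formalLog -
          PowerSeries.C (algebraMap F (CompletedAlgClosure F) A) * (E₀.map (Int.castRingHom (CompletedAlgClosure F))).formalLog -
          PowerSeries.C (algebraMap F (CompletedAlgClosure F) B) *
            PowerSeries.expand p hpp.out.ne_zero (E₀.map (Int.castRingHom (CompletedAlgClosure F))).formalLog)‖ ≤ 1)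
    (u w : ℕ → (maxNilIdealC F).toIdeal) (hu : ∀ n, AinfRamTop.mulPC (D := D) W (u (n + 1)) = u n)
    (hw : ∀ n, AinfTop.mulPC F p E₀ (w (n + 1)) = w n)
    (hwu : ∀ n, ‖(((w n : (maxNilIdealC F).toIdeal) : CBall F) : CompletedAlgClosure F) -
      (((u n : (maxNilIdealC F).toIdeal) : CBall F) : CompletedAlgClosure F)‖ ≤ ‖((D.rootC : integerC F) : CompletedAlgClosure F)‖)
    {N : ℕ} (hN : 1 ≤ N) {z : bmaxZero F p}
    (hz : algebraMap (Ainf (p := p) F) (bmaxZero F p) ((AinfTop.of F p).symm (AinfTop.torsionLift E₀ hθ w hw)) ^ N = (p : bmaxZero F p) * z) :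
    thetaBdR (embBdRHom hp hθ A *
        bmaxPlusToBdR F p (PadicLogSeries.logSum ((algebraMap (Ainf (p := p) F) (bmaxZero F p)).comp zpToAinf) (GaloisContinuity.formalLogNum E₀ p) N
          (algebraMap (Ainf (p := p) F) (bmaxZero F p) ((AinfTop.of F p).symm (AinfTop.torsionLift E₀ hθ w hw))) z) +
      embBdRHom hp hθ B *
        bmaxPlusToBdR F p (frobBmaxPlus F p
          (PadicLogSeries.logSum ((algebraMap (Ainf (p := p) F) (bmaxZero F p)).comp zpToAinf) (GaloisContinuity.formalLogNum E₀ p) N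
            (algebraMap (Ainf (p := p) F) (bmaxZero F p) ((AinfTop.of F p).symm (AinfTop.torsionLift E₀ hθ w hw))) z))) =
      (p : CompletedAlgClosure F) ^ N *
        ∑' j : ℕ, PowerSeries.coeff j (W.map ((CBall F).subtype.comp (EisensteinRoot.CoeffDisc.toCBall D))).formalLog *
          (((u 0 : (maxNilIdealC F).toIdeal) : CBall F) : CompletedAlgClosure F) ^ j := by
  obtain ⟨𝒞, h𝒞w, -, heval⟩ := tsum_formalLog_eq_hodgeLine_eval D W E₀ (algebraMap F (CompletedAlgClosure F) A)
    (algebraMap F (CompletedAlgClosure F) B) d hHL u w hu hw hwu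
  rw [map_add, map_mul, map_mul, thetaBdR_embBdRHom, thetaBdR_embBdRHom,
    AinfTop.thetaBdR_bmaxPlusToBdR_logSum_torsionLift_eq_pow_mul_tsum E₀ hp hN hw hz,
    AinfTop.thetaBdR_bmaxPlusToBdR_frobBmaxPlus_logSum_eq_pow_mul_colmez E₀ hp hN hw hz h𝒞w, heval]
  ring

set_option maxHeartbeats 1600000 in
/-- ★★ **On the Tate module the Hodge combination is `Fil¹`-valued**: in the situation of `thetaBdR_transportedHodgeCombination_eq`, if `u₀ = 0` (a `[p]_{W_D}`-division
tower of the origin, `u ∈ T_pŴ_D`) then `θ_dR(emb(A)·f(Λ_w) + emb(B)·f(φΛ_w)) = 0` — although `w₀ = (Tu)₀ ≠ 0` and neither `θ(fΛ_w)` nor `θ(fφΛ_w)` vanishes in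
general. [cite: Colmez1992PeriodesAbeliennes, §2] [cite: Katz1981CrystallineDieudonne, Thm. 5.1.4–5.1.5, Thm. 5.3.3] -/
theorem thetaBdR_transportedHodgeCombination_eq_zero_of_torsion (W : WeierstrassCurve (EisensteinRoot.CoeffDisc D)) (E₀ : WeierstrassCurve ℤ)
    (A B : F) (d : ℕ)
    (hHL : ∀ n : ℕ, ‖(p : CompletedAlgClosure F) ^ d * PowerSeries.coeff n
        ((W.map ((CBall F).subtype.comp (EisensteinRoot.CoeffDisc.toCBall D))).formalLog -
          PowerSeries.C (algebraMap F (CompletedAlgClosure F) A) * (E₀.map (Int.castRingHom (CompletedAlgClosure F))).formalLog -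
          PowerSeries.C (algebraMap F (CompletedAlgClosure F) B) *
            PowerSeries.expand p hpp.out.ne_zero (E₀.map (Int.castRingHom (CompletedAlgClosure F))).formalLog)‖ ≤ 1)
    (u w : ℕ → (maxNilIdealC F).toIdeal) (hu : ∀ n, AinfRamTop.mulPC (D := D) W (u (n + 1)) = u n)
    (hu0 : (((u 0 : (maxNilIdealC F).toIdeal) : CBall F) : CompletedAlgClosure F) = 0)
    (hw : ∀ n, AinfTop.mulPC F p E₀ (w (n + 1)) = w n)
    (hwu : ∀ n, ‖(((w n : (maxNilIdealC F).toIdeal) : CBall F) : CompletedAlgClosure F) -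
      (((u n : (maxNilIdealC F).toIdeal) : CBall F) : CompletedAlgClosure F)‖ ≤ ‖((D.rootC : integerC F) : CompletedAlgClosure F)‖)
    {N : ℕ} (hN : 1 ≤ N) {z : bmaxZero F p}
    (hz : algebraMap (Ainf (p := p) F) (bmaxZero F p) ((AinfTop.of F p).symm (AinfTop.torsionLift E₀ hθ w hw)) ^ N = (p : bmaxZero F p) * z) :
    thetaBdR (embBdRHom hp hθ A *
        bmaxPlusToBdR F p (PadicLogSeries.logSum ((algebraMap (Ainf (p := p) F) (bmaxZero F p)).comp zpToAinf) (GaloisContinuity.formalLogNum E₀ p) N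
          (algebraMap (Ainf (p := p) F) (bmaxZero F p) ((AinfTop.of F p).symm (AinfTop.torsionLift E₀ hθ w hw))) z) +
      embBdRHom hp hθ B *
        bmaxPlusToBdR F p (frobBmaxPlus F p
          (PadicLogSeries.logSum ((algebraMap (Ainf (p := p) F) (bmaxZero F p)).comp zpToAinf) (GaloisContinuity.formalLogNum E₀ p) N
            (algebraMap (Ainf (p := p) F) (bmaxZero F p) ((AinfTop.of F p).symm (AinfTop.torsionLift E₀ hθ w hw))) z))) = 0 := by
  have h := pow_mul_tsum_formalLog_mulPC_divisionSeq_eq_zero D W u hu hu0 0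
  rw [pow_zero, one_mul] at h
  rw [thetaBdR_transportedHodgeCombination_eq D W E₀ A B d hHL u w hu hw hwu hN hz, h, mul_zero]

end AinfRamTop

end Literature.NumberTheory.PAdicHodge
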